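import Summits.QuantumFields.YangMills.Theorems.BalabanUVNodesN15KingModelBlockContours
import Summits.QuantumFields.YangMills.Theorems.BalabanUVNodesN15KingModelCovariantKatoDomination
import HarnessLib

/-!
# BalabanUVNodes ∕ N15 — THE KING-MODEL RUNG (PART Ϥ-c): BAŁABAN's COVARIANT BLOCK MEAN `Q(U)` ON KING's TORUS AT EVERY LINK FIELD —
# `(Q(U)v)(y) = L^{−(d+1)}Σ_{x∈B(y)}U(Γ_{y,x})v(x)` ([B9] (3.19) p.393; King (2.11) p.653 at one level) for an ARBITRARY tree contour system and an ARBITRARY `U` (any fibre `𝕜ⁿ`):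
# the block formula = the MEAN OF THE TRANSPORTED FIELD; `Q(1)` = King's plain block mean; `Q(U)Q(U)^* = L^{−(d+1)}·1` EXACTLY at every unitary `U`; GAUGE COVARIANCE (3.32) BY NAME
# (Track A, DAG node N15 = NE2; FAN-OUT v1.1 §N15 s3 «KING-MODEL RUNG … + what the curved case adds»; count-neutral)

HONEST FRAMING.  Count-neutral (cell `pub-ymgap`, seat `pub-ymgap-dag-n15-e` g49; `--supports stmt-QuantumFields-27247 --as helper` = K3ᴬ, KEY MAP v3).  One-step covariant averaging
over King's `L`-blocks of `T_η = Π_μℤ∕(LM_μ)` (PART Ϥ-b contours and transports); at a constant abelian `U` this is the tree's `B5ToronOperators118.QsOpTw` (PART Ͷ∕Ͻ), at `U ≡ 1` King's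
`Q` ([King1986] (2.11), (4.1); tree `King1986.Torus.blockProj` for `Q^*Q`).  NOT Bałaban's multi-level `Q_k(U) = Q(Ū^{(k−1)})⋯Q(U)` of (3.15) (whose composite contours are King's nested
(2.12)); NOT (3.42); NOT a node discharge (N15 of record untouched); nothing continuum ∕ ℝ⁴ ∕ OS ∕ Clay.

THE OBJECTS AND RESULTS.  `covQ T M U : Matrix (T₁ × n) (T_η × n) 𝕜`, `covQ((y,i),(x,k)) = Σ_j [x = site y j]·L^{−(d+1)}·U(Γ_{y,site y j})_{ik}` (§1): ★ `covQ_mulVec_apply`, def `blockTransport U v y j =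
U(Γ_{y,x_j})v(x_j)` (the field of block `y` transported to the corner, `x_j = site y j`), ★★ **`fib_covQ_mulVec`** (`(Q(U)v)(y) = L^{−(d+1)}Σ_j U(Γ_{y,x_j})v(x_j)` = the MEAN of the
transported field, PART Ϥ-a `treeMean`), ★ `norm_blockTransport` (`‖U(Γ)v(x_j)‖ = ‖v(x_j)‖`, unitary `U`), `sum_norm_blockTransport_sq`; §2 ★ `covQ_const_one_apply` (`U ≡ 1`: `[x ∈ B(y)]L^{−(d+1)}δ_{ik}` —
King's block mean ⊗ 1); §3 ★★ **`covQ_mul_conjTranspose`** (`Q(U)Q(U)^* = L^{−(d+1)}·1` for EVERY unitary `U`: distinct blocks are disjoint and each transport is unitary); §4 def `cornerGauge g y =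
g(site y 0)` (a fine gauge read at the block corners), ★★ **`covQ_kingGaugeAct`** ([B9] (3.32) BY NAME in the model: `Q(U^g) = D_{g∘corner}·Q(U)·D_g^*`), `cornerGauge_mem_unitaryGroup`.
PRIOR TREE ART (by name): Ϥ-b (`BlockTree`, `treeHol`, `treeHol_root∕_of_ne_root∕_mem_unitaryGroup∕_const_one∕_kingGaugeAct`, `site_eq_parent_add_unitVec`), Ϥ-a (`treeMean`), Ͱ-a (`kingGaugeMat`,
`kingGaugeAct`), Ͱ-b (`fib`, `fib_apply`, `norm_toEuclideanLin_of_mem_unitaryGroup`), `King1986.Torus` (`site`, `blockEquiv`, `blockOf`, `blockOf_site`, `site_injective`), Mathlib.  Dedup (rg at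
filing): basename 0 files; needles `covQ|blockTransport|cornerGauge` 0 files in `Summits/QuantumFields/YangMills` + `Literature/MathematicalPhysics`.  presearch: n/a (definitions following the print).
Locators: [Balaban1985BackgroundPropagators] (3.19) p.393, (3.32) p.395; [King1986] (2.11)–(2.12) p.653, (4.1) p.670; [Balaban1984PropagatorsI] (1.7) p.18.  0 `sorry`.
-/

noncomputable section
open scoped BigOperators ComplexConjugate
open Finset Matrix WithLp

namespace Summit.QuantumFields.YangMills.BalabanUVNodes.N15KingModelRung.CovariantBlock

open Literature.MathematicalPhysics.QuantumFieldTheory.Balaban1983to89.B5Prop11Plancherel (Tor fine unitVec)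
open Literature.MathematicalPhysics.QuantumFieldTheory.King1986.Torus (site site_injective blockEquiv blockEquiv_apply blockOf blockOf_site)
open Summit.QuantumFields.YangMills.BalabanUVNodes.N15KingModelRung.Covariant (kingGaugeMat kingGaugeAct fib fib_apply norm_toEuclideanLin_of_mem_unitaryGroup)

variable {d : ℕ} {L : ℕ} [NeZero L] (T : BlockTree d L) (M : Fin (d + 1) → ℕ) [hM : ∀ μ, NeZero (M μ)]
variable {𝕜 : Type*} [RCLike 𝕜] {n : Type*} [Fintype n] [DecidableEq n]

/-! ## §1 The covariant block mean and its block formula -/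

/-- BAŁABAN's COVARIANT BLOCK MEAN `Q(U)` ([B9] (3.19)) on King's torus, for the tree contour system `T` and the link field `U`: the `(T₁ × n) × (T_η × n)` matrix with entries
`Σ_j [x = site y j]·L^{−(d+1)}·U(Γ_{y, site y j})_{ik}` — average over the block of `y` after transport to the corner. [cite: Balaban1985BackgroundPropagators, (3.19) p.393; King1986, (2.11) p.653] -/
def covQ (U : Tor (fine L M) × Fin (d + 1) → Matrix n n 𝕜) : Matrix (Tor M × n) (Tor (fine L M) × n) 𝕜 :=
  fun yi xk => ∑ j : Fin (d + 1) → Fin L, if xk.1 = site L M yi.1 j then ((L : 𝕜) ^ (d + 1))⁻¹ * treeHol M T U yi.1 j yi.2 xk.2 else 0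

/-- THE TRANSPORTED FIELD of block `y`: `j ↦ U(Γ_{y,x_j})v(x_j)`, `x_j = site y j`, a vector at the corner for each offset. [cite: Balaban1985BackgroundPropagators, (3.19) p.393] -/
def blockTransport (U : Tor (fine L M) × Fin (d + 1) → Matrix n n 𝕜) (v : Tor (fine L M) × n → 𝕜) (y : Tor M) (j : Fin (d + 1) → Fin L) : EuclideanSpace 𝕜 n :=
  Matrix.toEuclideanLin (treeHol M T U y j) (fib (fine L M) v (site L M y j))

/-- The entry of `Q(U)` at a block point: `Q(U)((y,i),(site y′ j, k)) = [y = y′]·L^{−(d+1)}·U(Γ_{y,site y j})_{ik}`. [cite: Balaban1985BackgroundPropagators, (3.19) p.393] -/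
theorem covQ_apply_site (U : Tor (fine L M) × Fin (d + 1) → Matrix n n 𝕜) (y y' : Tor M) (i k : n) (j : Fin (d + 1) → Fin L) :
    covQ T M U (y, i) (site L M y' j, k) = if y = y' then ((L : 𝕜) ^ (d + 1))⁻¹ * treeHol M T U y j i k else 0 := by
  simp only [covQ]
  by_cases hy : y = y'
  · subst hy
    rw [if_pos rfl, Finset.sum_eq_single j]
    · rw [if_pos rfl]
    · intro j' _ hj'
      rw [if_neg]
      intro h
      exact hj' ((Prod.mk.inj (site_injective L M (a₁ := (y, j)) (a₂ := (y, j')) h)).2).symm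
    · intro h; exact absurd (Finset.mem_univ j) h
  · rw [if_neg hy]
    refine Finset.sum_eq_zero fun j' _ => ?_
    rw [if_neg]
    intro h
    exact hy ((Prod.mk.inj (site_injective L M (a₁ := (y', j)) (a₂ := (y, j')) h)).1).symm

/-- ★ THE BLOCK FORMULA: `(Q(U)v)(y,i) = L^{−(d+1)}Σ_j (U(Γ_{y,x_j})v(x_j))_i`. [cite: Balaban1985BackgroundPropagators, (3.19) p.393; King1986, (2.11) p.653] -/
theorem covQ_mulVec_apply (U : Tor (fine L M) × Fin (d + 1) → Matrix n n 𝕜) (v : Tor (fine L M) × n → 𝕜) (y : Tor M) (i : n) :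
    (covQ T M U *ᵥ v) (y, i) = ((L : 𝕜) ^ (d + 1))⁻¹ * ∑ j : Fin (d + 1) → Fin L, (treeHol M T U y j *ᵥ fun k => v (site L M y j, k)) i := by
  simp only [Matrix.mulVec, dotProduct, covQ]
  rw [Fintype.sum_prod_type]
  simp_rw [Finset.sum_mul, ite_mul, zero_mul]
  rw [Finset.sum_comm]
  conv_lhs => arg 2; ext k; rw [Finset.sum_comm]
  rw [Finset.sum_comm, Finset.mul_sum]
  refine Finset.sum_congr rfl fun j _ => ?_
  rw [Finset.mul_sum]
  refine Finset.sum_congr rfl fun k _ => ?_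
  rw [Finset.sum_ite_eq' Finset.univ (site L M y j), if_pos (Finset.mem_univ _)]
  ring

/-- ★★ **THE COVARIANT BLOCK MEAN IS THE MEAN OF THE TRANSPORTED FIELD**: `(Q(U)v)(y) = L^{−(d+1)}Σ_j U(Γ_{y,x_j})v(x_j)` as a vector of `𝕜ⁿ` — PART Ϥ-a's `treeMean` of `blockTransport U v y`
over the `L^{d+1}` offsets. [cite: Balaban1985BackgroundPropagators, (3.19) p.393; King1986, (2.11) p.653] -/
theorem fib_covQ_mulVec (U : Tor (fine L M) × Fin (d + 1) → Matrix n n 𝕜) (v : Tor (fine L M) × n → 𝕜) (y : Tor M) :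
    fib M (covQ T M U *ᵥ v) y = treeMean (𝕜 := 𝕜) (blockTransport T M U v y) := by
  have hcard : (Fintype.card (Fin (d + 1) → Fin L) : 𝕜) = (L : 𝕜) ^ (d + 1) := by
    rw [Fintype.card_fun, Fintype.card_fin, Fintype.card_fin]; push_cast; ring
  ext i
  rw [fib_apply, covQ_mulVec_apply, treeMean, hcard, PiLp.smul_apply, smul_eq_mul, WithLp.ofLp_sum, Finset.sum_apply]
  congr 1

omit hM in
/-- ★ THE TRANSPORT PRESERVES FIBRE NORMS: `‖U(Γ_{y,x_j})v(x_j)‖ = ‖v(x_j)‖` (unitary `U`). [cite: Balaban1985BackgroundPropagators, (3.19) p.393] -/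
theorem norm_blockTransport {U : Tor (fine L M) × Fin (d + 1) → Matrix n n 𝕜} (hU : ∀ bd, U bd ∈ Matrix.unitaryGroup n 𝕜) (v : Tor (fine L M) × n → 𝕜) (y : Tor M)
    (j : Fin (d + 1) → Fin L) : ‖blockTransport T M U v y j‖ = ‖fib (fine L M) v (site L M y j)‖ :=
  norm_toEuclideanLin_of_mem_unitaryGroup (treeHol_mem_unitaryGroup T M hU y j) _

/-- `Σ_yΣ_j‖U(Γ)v(x_j)‖² = Σ_x‖v(x)‖²` (the block parametrisation is a bijection). [folklore] -/
theorem sum_norm_blockTransport_sq {U : Tor (fine L M) × Fin (d + 1) → Matrix n n 𝕜} (hU : ∀ bd, U bd ∈ Matrix.unitaryGroup n 𝕜) (v : Tor (fine L M) × n → 𝕜) :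
    ∑ y, ∑ j, ‖blockTransport T M U v y j‖ ^ 2 = ∑ x, ‖fib (fine L M) v x‖ ^ 2 := by
  simp_rw [norm_blockTransport T M hU]
  rw [← Fintype.sum_prod_type', ← (blockEquiv L M).sum_comp]
  rfl

/-! ## §2 `U ≡ 1`: King's plain block mean -/

/-- ★ AT `U ≡ 1` THE COVARIANT MEAN IS KING's BLOCK MEAN (⊗ 1): `Q(1)((y,i),(x,k)) = [x ∈ B(y)]·L^{−(d+1)}·δ_{ik}`. [cite: King1986, (2.11) p.653, (4.1) p.670; Balaban1985BackgroundPropagators, (3.19) p.393] -/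
theorem covQ_const_one_apply (y : Tor M) (i : n) (x : Tor (fine L M)) (k : n) :
    covQ T M (fun _ => (1 : Matrix n n 𝕜)) (y, i) (x, k) = if blockOf L M x = y ∧ i = k then ((L : 𝕜) ^ (d + 1))⁻¹ else 0 := by
  obtain ⟨⟨y', j⟩, rfl⟩ := (blockEquiv L M).surjective x
  rw [blockEquiv_apply, covQ_apply_site, treeHol_const_one, blockOf_site]
  by_cases hy : y = y'
  · subst hy
    simp only [true_and, if_true, Matrix.one_apply, mul_ite, mul_one, mul_zero]
  · rw [if_neg hy, if_neg (fun h => hy h.1.symm)]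

/-! ## §3 `Q(U)Q(U)^* = L^{−(d+1)}` at every unitary `U` -/

/-- ★★ **`Q(U)Q(U)^* = L^{−(d+1)}·1` EXACTLY, for every unitary link field and every tree contour system**: different blocks are disjoint, and within a block
`Σ_j L^{−2(d+1)}U(Γ_j)U(Γ_j)^* = L^{−(d+1)}·1`. [cite: Balaban1985BackgroundPropagators, (3.19) p.393; King1986, (4.1)–(4.3) p.670] -/
theorem covQ_mul_conjTranspose {U : Tor (fine L M) × Fin (d + 1) → Matrix n n 𝕜} (hU : ∀ bd, U bd ∈ Matrix.unitaryGroup n 𝕜) :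
    covQ T M U * (covQ T M U)ᴴ = ((L : 𝕜) ^ (d + 1))⁻¹ • (1 : Matrix (Tor M × n) (Tor M × n) 𝕜) := by
  have hL : ((L : 𝕜) ^ (d + 1)) ≠ 0 := pow_ne_zero _ (by exact_mod_cast NeZero.ne L)
  have hhol : ∀ y j, treeHol M T U y j * (treeHol M T U y j)ᴴ = 1 := fun y j => by
    have := Matrix.mem_unitaryGroup_iff.mp (treeHol_mem_unitaryGroup T M hU y j); simpa only [star_eq_conjTranspose] using this
  ext ⟨y, i⟩ ⟨y', i'⟩
  rw [Matrix.mul_apply, Matrix.smul_apply, Fintype.sum_prod_type, ← (blockEquiv L M).sum_comp, Fintype.sum_prod_type]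
  simp only [blockEquiv_apply, Matrix.conjTranspose_apply, covQ_apply_site]
  by_cases hy : y = y'
  · subst hy
    rw [Finset.sum_eq_single y]
    · simp only [if_true]
      have : ∑ j : Fin (d + 1) → Fin L, ∑ k, ((L : 𝕜) ^ (d + 1))⁻¹ * treeHol M T U y j i k * star (((L : 𝕜) ^ (d + 1))⁻¹ * treeHol M T U y j i' k)
          = ∑ j : Fin (d + 1) → Fin L, ((L : 𝕜) ^ (d + 1))⁻¹ * ((L : 𝕜) ^ (d + 1))⁻¹ * (treeHol M T U y j * (treeHol M T U y j)ᴴ) i i' := by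
        refine Finset.sum_congr rfl fun j _ => ?_
        rw [Matrix.mul_apply, Finset.mul_sum]
        refine Finset.sum_congr rfl fun k _ => ?_
        simp only [Matrix.conjTranspose_apply, star_mul', RCLike.star_def, map_inv₀, map_pow, map_natCast]
        ring
      rw [this]
      simp only [hhol, Matrix.one_apply, Prod.mk.injEq, true_and, smul_eq_mul]
      rw [Finset.sum_const, Finset.card_univ, Fintype.card_fun, Fintype.card_fin, Fintype.card_fin, nsmul_eq_mul]
      push_cast
      by_cases hi : i = i'
      · rw [if_pos hi]; field_simp
      · rw [if_neg hi]; ring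
    · intro b _ hb
      refine Finset.sum_eq_zero fun j _ => Finset.sum_eq_zero fun k _ => ?_
      rw [if_neg (Ne.symm hb), zero_mul]
    · intro h; exact absurd (Finset.mem_univ y) h
  · have hne : ((y, i) : Tor M × n) ≠ (y', i') := fun h => hy (Prod.mk.inj h).1
    rw [Matrix.one_apply_ne hne, smul_zero]
    refine Finset.sum_eq_zero fun b _ => Finset.sum_eq_zero fun j _ => Finset.sum_eq_zero fun k _ => ?_
    by_cases hb : y = b
    · subst hb; rw [if_pos rfl, if_neg (fun h => hy h.symm), star_zero, mul_zero]
    · rw [if_neg hb, zero_mul]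

/-! ## §4 Gauge covariance ([B9] (3.32)) -/

/-- THE CORNER GAUGE: a gauge transformation `g` of the fine torus read at the block corners, `y ↦ g(site y 0)` — the gauge acting on block fields. [cite: Balaban1985BackgroundPropagators, (3.32) p.395] -/
def cornerGauge (g : Tor (fine L M) → Matrix n n 𝕜) (y : Tor M) : Matrix n n 𝕜 := g (site L M y T.root)

omit hM in
/-- The corner gauge is unitary when `g` is. [folklore] -/
theorem cornerGauge_mem_unitaryGroup {g : Tor (fine L M) → Matrix n n 𝕜} (hg : ∀ x, g x ∈ Matrix.unitaryGroup n 𝕜) (y : Tor M) : cornerGauge T M g y ∈ Matrix.unitaryGroup n 𝕜 := hg _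

/-- ★★ **GAUGE COVARIANCE OF THE COVARIANT BLOCK MEAN** ([B9] (3.32) «(Q′_j(U^u)R(u)λ)(y) = R(u(y))(Q′_j(U)λ)(y)» in the model): `Q(U^g) = D_{g∘corner}·Q(U)·D_g^*` for every unitary gauge `g`
(Ͱ-a `kingGaugeMat`, `kingGaugeAct`). [cite: Balaban1985BackgroundPropagators, (3.32) p.395, (3.28) p.395] -/
theorem covQ_kingGaugeAct {g : Tor (fine L M) → Matrix n n 𝕜} (hg : ∀ x, g x ∈ Matrix.unitaryGroup n 𝕜) (U : Tor (fine L M) × Fin (d + 1) → Matrix n n 𝕜) :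
    covQ T M (kingGaugeAct (fine L M) g U) = kingGaugeMat M (cornerGauge T M g) * covQ T M U * (kingGaugeMat (fine L M) g)ᴴ := by
  ext ⟨y, i⟩ ⟨x, k⟩
  obtain ⟨⟨y', j⟩, rfl⟩ := (blockEquiv L M).surjective x
  rw [blockEquiv_apply, covQ_apply_site, treeHol_kingGaugeAct T M hg U y j]
  -- right side: Σ_{(x',k')} (D_c Q)((y,i),(x',k')) * conj(D_g((site y' j,k),(x',k')))
  have hR : ∀ xk : Tor (fine L M) × n, (kingGaugeMat M (cornerGauge T M g) * covQ T M U) (y, i) xk * (kingGaugeMat (fine L M) g)ᴴ xk (site L M y' j, k)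
      = if xk.1 = site L M y' j then (∑ i', cornerGauge T M g y i i' * covQ T M U (y, i') xk) * star (g (site L M y' j) k xk.2) else 0 := by
    rintro ⟨x', k'⟩
    rw [Matrix.conjTranspose_apply, kingGaugeMat]
    simp only
    by_cases hx : x' = site L M y' j
    · subst hx
      rw [if_pos rfl, if_pos rfl, Matrix.mul_apply, Fintype.sum_prod_type]
      congr 1
      rw [Finset.sum_eq_single y]
      · simp only [kingGaugeMat, if_true]
      · intro b _ hb; refine Finset.sum_eq_zero fun i' _ => ?_; simp only [kingGaugeMat, if_neg (Ne.symm hb), zero_mul]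
      · intro h; exact absurd (Finset.mem_univ y) h
    · rw [if_neg (fun h => hx h.symm), if_neg hx, star_zero, mul_zero]
  symm
  rw [Matrix.mul_apply]
  simp_rw [hR]
  rw [Fintype.sum_prod_type, Finset.sum_comm]
  simp_rw [Finset.sum_ite_eq' Finset.univ (site L M y' j), if_pos (Finset.mem_univ _)]
  simp only [covQ_apply_site]
  by_cases hy : y = y'
  · subst hy
    simp only [if_true]
    rw [Matrix.mul_apply, Finset.mul_sum]
    refine Finset.sum_congr rfl fun k' _ => ?_
    rw [Matrix.mul_apply, Matrix.conjTranspose_apply, Finset.sum_mul, Finset.sum_mul, Finset.mul_sum]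
    refine Finset.sum_congr rfl fun i' _ => ?_
    simp only [cornerGauge]
    ring
  · simp only [if_neg hy, mul_zero, Finset.sum_const_zero, zero_mul]

end Summit.QuantumFields.YangMills.BalabanUVNodes.N15KingModelRung.CovariantBlock

end
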